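import Summits.QuantumFields.YangMills.Theorems.UnitScaleTiltProp7HqVOfTraceBound
import Summits.QuantumFields.YangMills.Theorems.UnitScaleTiltProp7SectET3HilbertLettersT3
import HarnessLib

/-!
# Route `UnitScaleTilt`, crux «MinimiserStabilityRegPr» (stmt-QuantumFields-19200, stub EX `stub_existenceMinimalOrbit`), route (α) —
# **«HQV-AT-RECORD»: S15ᴰ's DISPLAYED ROW `hqV` (✓`Prop7StubEXOfChartPiecesTwS15D` :125–127) AT THE LETTERS OF RECORD `(ρ₂, τ₂) := (rieszτ frobEquiv, tr)`, FROM THE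
# OPERATOR-NORM NUMERAL `hMρ : ‖rieszτ frobEquiv‖ ≤ Mρ` ALONE** — the S16 feed asked for by the EX namer (2026-08-29T01:05:18Z (i) «name the family wrapper»): ✓p683712
# `hqV_bgOfCfg_of_regPr_trace_family` (this seat) read at `ρ := α L` with `hρ` discharged by `le_opNorm`.

Cell `ym3-torus` (HUMAN RULING D-0037, YM ladder rung R3 — YM₃ on T³ is a rung, NOT d = 4, NOT a mass gap, NOT Clay; YM gap NOT proved), width seat `ym3-torus-px19` (gen 4).
THEOREMS ONLY (0 `def`, 0 `sorry`); `--supports stmt-QuantumFields-19200 --as helper`; count-neutral; NO claim on crux ∕ stub ∕ registry; nothing of print asserted.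

WHAT IS PROVED (ns `…Theorems.Prop7HqVAtRecordFamily`).  `norm_rieszτ_frobEquiv_apply_le` (`‖ρ₂ ℓ‖ ≤ Mρ‖ℓ‖` from `‖ρ₂‖ ≤ Mρ`); ★★`hqV_family_of_opNorm` — S15ᴰ's `hqV` text with the
EXPLICIT constant `CV L := 2·(1024·2·Mρ·(α L + 1∕16) + 2·138·Mρ)`; ★★`hqV_family_of_opNorm_le` — S15ᴰ's `hqV` text VERBATIM (free `CV L`) from ONE numeric row
`hCVge : ∀ L>1, 2·(1024·2·Mρ·(α L + 1∕16) + 2·138·Mρ) ≤ CV L`.  S16: `hqV := hqV_family_of_opNorm_le hα hMρ0 hMρ hCVge`.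
References: T. Bałaban, CMP 102 (1985) 277–309 [Balaban1985Variational] ((90)–(96) pp.291–292, Prop. 4 (98) p.293); CMP 99 (1985) 389–434 [Balaban1985BackgroundPropagators] ((3.35) p.396).
-/

set_option autoImplicit false

noncomputable section

open scoped Matrix.Norms.L2Operator

namespace Summit.QuantumFields.YangMills.Theorems.Prop7HqVAtRecordFamily

open Literature.MathematicalPhysics.QuantumFieldTheory.Balaban1983to89
open Literature.MathematicalPhysics.QuantumFieldTheory.Balaban1983to89.T3ContinuumYM3Torus
open Literature.MathematicalPhysics.QuantumFieldTheory.Balaban1983to89.T3Thm1Carrier (Idx)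
open Literature.MathematicalPhysics.QuantumFieldTheory.Balaban1983to89.T3PrintedRegularMinimiser (RegPr)
open Literature.MathematicalPhysics.QuantumFieldTheory.Balaban1983to89.B11Eq63V0GroupCurrent (curV0)
open Literature.MathematicalPhysics.QuantumFieldTheory.Balaban1983to89.B11Eq98V0primeCurrentSlots (rieszτ)
open B9SectCLatticeCarrier (Bond)
open B11Eq115Space (Space115)
open B11Eq111FrakG (nabla115)
open Summit.QuantumFields.YangMills.Theorems.Prop7SectET3Transport (periodsT3 bgOfCfg)
open Summit.QuantumFields.YangMills.Theorems.Prop7SectET3HilbertLetters (frobEquiv)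
open Summit.QuantumFields.YangMills.Theorems.Prop7HqVOfTraceBound (hqV_bgOfCfg_of_regPr_trace_family)

/-- The applied norm row of the fibre letter of record from its operator-norm numeral (S15ᴰ's `hMρ`, ★px21 ✓`Prop7RieszTauFrobNorm`): `‖ρ₂ ℓ‖ ≤ Mρ·‖ℓ‖`. [folklore] -/
theorem norm_rieszτ_frobEquiv_apply_le {Mρ : ℝ}
    (hMρ : ‖((rieszτ frobEquiv) : (Matrix (Fin 2) (Fin 2) ℂ →L[ℂ] ℂ) →L[ℂ] Matrix (Fin 2) (Fin 2) ℂ)‖ ≤ Mρ)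
    (ℓ : Matrix (Fin 2) (Fin 2) ℂ →L[ℂ] ℂ) : ‖rieszτ frobEquiv ℓ‖ ≤ Mρ * ‖ℓ‖ :=
  (ContinuousLinearMap.le_opNorm _ ℓ).trans (mul_le_mul_of_nonneg_right hMρ (norm_nonneg ℓ))

variable [hFL : ∀ F : T3Family, Fact (0 < (F.L : ℝ))] [hFη : ∀ (F : T3Family) (k : ℕ), Fact (0 < ((F.L : ℝ)⁻¹) ^ k)]

/-- ★★ **S15ᴰ's DISPLAYED ROW `hqV` AT THE EXPLICIT CONSTANT `CV L := 2·(1024·2·Mρ·(α L + 1∕16) + 2·138·Mρ)`**, from `hα`, `hMρ0` and the operator-norm numeral `hMρ` only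
(letters of record `ρ₂ := rieszτ frobEquiv`, `τ₂ := tr`; ✓p683712 §4 at `ρ := α L`). [cite: Balaban1985Variational, (90)–(96) pp.291–292, Prop. 4 (98) p.293; Balaban1985BackgroundPropagators, (3.35) p.396] -/
theorem hqV_family_of_opNorm {α : ℕ → ℝ} (hα : ∀ L, 1 < L → 0 < α L) {Mρ : ℝ} (hMρ0 : 0 ≤ Mρ)
    (hMρ : ‖((rieszτ frobEquiv) : (Matrix (Fin 2) (Fin 2) ℂ →L[ℂ] ℂ) →L[ℂ] Matrix (Fin 2) (Fin 2) ℂ)‖ ≤ Mρ) :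
    ∀ (L : ℕ), 1 < L → ∀ (i : Idx L) (U₀ : GaugeField (i.1.1.P i.1.2.2) 0 (Matrix.specialUnitaryGroup (Fin 2) ℂ)), RegPr i.1.1 i.1.2.1 i.1.2.2 (α L) U₀ →
      ∀ Y : Space115 (i.1.1.L : ℝ) (((i.1.1.L : ℝ)⁻¹) ^ (i.1.2.2 - i.1.2.1)) (fun _ : Bond 3 (periodsT3 i.1.1 i.1.2.2) => i.1.2.2 - i.1.2.1)
          (fun _ : Bond 3 (periodsT3 i.1.1 i.1.2.2) × Fin 3 => i.1.2.2 - i.1.2.1) (nabla115 (((i.1.1.L : ℝ)⁻¹) ^ (i.1.2.2 - i.1.2.1)) (bgOfCfg i.1.1 i.1.2.2 U₀)), ‖Y‖ < 1 / 16 →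
        ‖curV0 (lev₁ := fun _ : Bond 3 (periodsT3 i.1.1 i.1.2.2) × Fin 3 => i.1.2.2 - i.1.2.1) (Dc := nabla115 (((i.1.1.L : ℝ)⁻¹) ^ (i.1.2.2 - i.1.2.1)) (bgOfCfg i.1.1 i.1.2.2 U₀))
            (rieszτ frobEquiv) (LinearMap.toContinuousLinearMap (Matrix.traceLinearMap (Fin 2) ℂ ℂ)) (bgOfCfg i.1.1 i.1.2.2 U₀) Y‖ ≤
          (2 * (1024 * ((3 - 1 : ℕ) : ℝ) * Mρ * (α L + 1 / 16) + ((3 - 1 : ℕ) : ℝ) * 138 * Mρ)) * ‖Y‖ ^ 2 := by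
  intro L hL i U₀ hreg Y hY
  exact hqV_bgOfCfg_of_regPr_trace_family hα (rieszτ frobEquiv) hMρ0 (norm_rieszτ_frobEquiv_apply_le hMρ) L hL i (α L) U₀ hreg le_rfl Y hY

/-- ★★ **S15ᴰ's DISPLAYED ROW `hqV` VERBATIM (free constant `CV L`)** from `hα hMρ0 hMρ` and ONE numeric row `hCVge : ∀ L>1, 2·(1024·2·Mρ·(α L + 1∕16) + 2·138·Mρ) ≤ CV L`;
the S16 feed is `hqV := hqV_family_of_opNorm_le hα hMρ0 hMρ hCVge`. [cite: Balaban1985Variational, (90)–(96) pp.291–292, Prop. 4 (98) p.293; Balaban1985BackgroundPropagators, (3.35) p.396] -/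
theorem hqV_family_of_opNorm_le {α CV : ℕ → ℝ} (hα : ∀ L, 1 < L → 0 < α L) {Mρ : ℝ} (hMρ0 : 0 ≤ Mρ)
    (hMρ : ‖((rieszτ frobEquiv) : (Matrix (Fin 2) (Fin 2) ℂ →L[ℂ] ℂ) →L[ℂ] Matrix (Fin 2) (Fin 2) ℂ)‖ ≤ Mρ)
    (hCVge : ∀ L, 1 < L → 2 * (1024 * ((3 - 1 : ℕ) : ℝ) * Mρ * (α L + 1 / 16) + ((3 - 1 : ℕ) : ℝ) * 138 * Mρ) ≤ CV L) :
    ∀ (L : ℕ), 1 < L → ∀ (i : Idx L) (U₀ : GaugeField (i.1.1.P i.1.2.2) 0 (Matrix.specialUnitaryGroup (Fin 2) ℂ)), RegPr i.1.1 i.1.2.1 i.1.2.2 (α L) U₀ →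
      ∀ Y : Space115 (i.1.1.L : ℝ) (((i.1.1.L : ℝ)⁻¹) ^ (i.1.2.2 - i.1.2.1)) (fun _ : Bond 3 (periodsT3 i.1.1 i.1.2.2) => i.1.2.2 - i.1.2.1)
          (fun _ : Bond 3 (periodsT3 i.1.1 i.1.2.2) × Fin 3 => i.1.2.2 - i.1.2.1) (nabla115 (((i.1.1.L : ℝ)⁻¹) ^ (i.1.2.2 - i.1.2.1)) (bgOfCfg i.1.1 i.1.2.2 U₀)), ‖Y‖ < 1 / 16 →
        ‖curV0 (lev₁ := fun _ : Bond 3 (periodsT3 i.1.1 i.1.2.2) × Fin 3 => i.1.2.2 - i.1.2.1) (Dc := nabla115 (((i.1.1.L : ℝ)⁻¹) ^ (i.1.2.2 - i.1.2.1)) (bgOfCfg i.1.1 i.1.2.2 U₀))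
            (rieszτ frobEquiv) (LinearMap.toContinuousLinearMap (Matrix.traceLinearMap (Fin 2) ℂ ℂ)) (bgOfCfg i.1.1 i.1.2.2 U₀) Y‖ ≤ CV L * ‖Y‖ ^ 2 := by
  intro L hL i U₀ hreg Y hY
  exact (hqV_family_of_opNorm hα hMρ0 hMρ L hL i U₀ hreg Y hY).trans (mul_le_mul_of_nonneg_right (hCVge L hL) (sq_nonneg _))

end Summit.QuantumFields.YangMills.Theorems.Prop7HqVAtRecordFamily

end
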